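import Summits.Ventures.WeilGRH.ZetaWindowAtomsLimit
import Summits.Ventures.WeilGRH.TwistedWindowMeasureGrowth
import Summits.Ventures.WeilGRH.FlatWindowSpectralGRH
import Summits.RiemannHypothesis.RiemannHypothesis.Theorems.HandoffCramerBump
import HarnessLib

/-!
# GRH arm (rh-explicit, venture WeilGRH): THE MULTIPLICITY IS THE LIMIT, `χ`-TWIN — the twisted window
  forms of the modulated flat windows are COMPLETE multiplicity certificates for `L(s, χ)`; under GRH
  the order of every zero (and `L(½, χ) ≠ 0`) is DECIDED BY ONE FINITE WINDOW

Cell `rh-explicit`, WEIL TRACK (structure seat weil-3, gen10) for the GRH ARM.  The `χ`-twin of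
`ZetaWindowAtomsLimit.lean` (no pole), built on gen7's window closure for the twisted form
(`TwistedWindowMeasure.twistedWindowForm_eq_integral`), gen9's automatic growth law
(`integrable_inv_one_add_sq_of_represents`) and the Fejér-profile bounds of `ZetaWindowAtomsLimit`.
For `χ` mod `q ≠ 1`, `u_{a,τ} = e^{−iτx}χ_0`, `T^χ_a(u) := 𝓔^χ_a(u) − M^χ_a‖u‖₂²` (the twisted window form):

* one window (GRH-free, every positive `μ` representing `Q_χ` on the tests of `[-a, a]`):
  `two_mul_mul_atom_le_twistedWindowForm` (`2a·μ{τ} ≤ T^χ_a(u_{a,τ})`),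
  `mul_measureReal_Icc_le_twistedWindowForm` (`(8a/π²)·μ[τ − π/(2a), τ + π/(2a)] ≤ T^χ_a(u_{a,τ})`),
  `twistedWindowForm_modulated_le_atom_add` (`T^χ_a(u_{a,τ}) ≤ 2a·μ{τ} + (2/a)∫(t−τ)⁻²dμ`);
* `twistedWindowForm_modulated_le_budget` (prime side) and ★ `measureReal_Icc_le_log_char` (GRH-free): every
  χ-window measure of ONE rung is locally log-sparse, `μ[τ ± π/(2a)] ≤ (π²/8a)(log q − K_κ + log(1+|τ|) + 3 − ψ(¼) + 5/a + prime budget)`;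
* all windows (GRH-free): **`tendsto_twistedWindowForm_modulated_div`**: `T^χ_a(u_{a,τ})/(2a) → μ{τ}`;
* under `GRH(χ)` (`χ` primitive; `μ` = the zeros, `ν_χ{τ} = ord_{s=½+iτ}L(s,χ)`):
  `two_mul_mul_charZeroOrder_le_twistedWindowForm`, **`tendsto_twistedWindowForm_modulated_div_of_grh`**,
  **`charZeroOrder_le_iff_of_grh`** (`ord_{s=½+iτ} L(s,χ) ≤ k ↔ ∃ a > 0, T^χ_a(u_{a,τ}) < 2a(k+1)`), and at
  the central point, with gen7's closed form of the flat window,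
  **`LFunction_one_half_ne_zero_iff_of_grh`**:
  `L(½, χ) ≠ 0 ↔ ∃ a > 0, log q − [2Σ_{log n<2a}Λ(n)n^{-1/2}(1 − log n/(2a))Re χ(n) + K_κ − I_κ(a)/a] < 2a`
  — under GRH the non-vanishing of `L(s, χ)` at the central point is EQUIVALENT to ONE explicit finite
  inequality among the prime powers below some `e^{2a}` (sound at every window, complete in the limit), and
  `twistedFlatWindow_lt_of_grh`: every window with `a² > Σ_ρ m_ρ/γ_ρ²` works (CERTIFICATE LENGTH = root of the
  second inverse moment of the zeros).

No definitions, no named facts; GRH only where named.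
-/

set_option autoImplicit false

noncomputable section

open Complex Filter Set MeasureTheory
open scoped Real Topology ComplexConjugate ArithmeticFunction.vonMangoldt

namespace Summit.Ventures.WeilGRH

open Literature.NumberTheory.LFunctions
open Literature.NumberTheory.LFunctions.Yoshida1992 (chi chiCore)
open Literature.NumberTheory.LFunctions.WeilBochner (charZeroHeightMeasure)
open Summit.RiemannHypothesis.RiemannHypothesis.Theorems.WeilFormatC

variable {q : ℕ} {a : ℝ}

/-! ## One window: the twisted window form of the modulated flat window bounds the atom and an interval -/

/-- The twisted window form of `u_{a,τ} = e^{−iτx}χ_0` is the Fejér integral of `μ` centred at `τ`. -/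
theorem twistedWindowForm_modulated_eq_integral (hq : q ≠ 1) (χ : DirichletCharacter ℂ q) (ha : 0 < a)
    {μ : Measure ℝ}
    (hμ : ∀ g : ℝ → ℂ, IsWeilTest g → tsupport g ⊆ Icc (-a) a →
      Integrable (fun t : ℝ ↦ ‖weilMellin g (1 / 2 + t * I)‖ ^ 2) μ ∧
        weilQuadraticChar χ g = ((∫ t, ‖weilMellin g (1 / 2 + t * I)‖ ^ 2 ∂μ : ℝ) : ℂ)) (τ : ℝ) :
    Integrable (fun t : ℝ ↦
        ‖weilMellin (fun x ↦ cexp (I * ((-τ) * x : ℝ)) * chi a 0 x) (1 / 2 + t * I)‖ ^ 2) μ ∧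
      weilDirichletEnergyChar χ a (fun x ↦ cexp (I * ((-τ) * x : ℝ)) * chi a 0 x) -
          weilMarkovConstantChar χ a =
        ∫ t, ‖weilMellin (fun x ↦ cexp (I * ((-τ) * x : ℝ)) * chi a 0 x) (1 / 2 + t * I)‖ ^ 2 ∂μ := by
  obtain ⟨hf, huf⟩ := modulated_chi_zero_smooth_inside a (-τ)
  obtain ⟨hint, heq⟩ := twistedWindowForm_eq_integral hq χ ha hμ
    (integrable_inv_one_add_sq_of_represents χ ha hμ) (isWindowFunction_modulated_chi_zero ha (-τ)) hf huf
  rw [integral_norm_sq_modulated_chi_zero ha, mul_one] at heq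
  exact ⟨hint, heq⟩

/-- **EVERY TWISTED WINDOW-FORM VALUE IS A MULTIPLICITY CERTIFICATE** (one window, GRH-free):
`2a·μ{τ} ≤ 𝓔^χ_a(e^{−iτx}χ_0) − M^χ_a`. -/
theorem two_mul_mul_atom_le_twistedWindowForm (hq : q ≠ 1) (χ : DirichletCharacter ℂ q) (ha : 0 < a)
    {μ : Measure ℝ}
    (hμ : ∀ g : ℝ → ℂ, IsWeilTest g → tsupport g ⊆ Icc (-a) a →
      Integrable (fun t : ℝ ↦ ‖weilMellin g (1 / 2 + t * I)‖ ^ 2) μ ∧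
        weilQuadraticChar χ g = ((∫ t, ‖weilMellin g (1 / 2 + t * I)‖ ^ 2 ∂μ : ℝ) : ℂ)) (τ : ℝ) :
    2 * a * μ.real {τ} ≤
      weilDirichletEnergyChar χ a (fun x ↦ cexp (I * ((-τ) * x : ℝ)) * chi a 0 x) -
        weilMarkovConstantChar χ a := by
  obtain ⟨hint, heq⟩ := twistedWindowForm_modulated_eq_integral hq χ ha hμ τ
  set u : ℝ → ℂ := fun x ↦ cexp (I * ((-τ) * x : ℝ)) * chi a 0 x with hu
  have h0 := measure_singleton_lt_top_of_integrable (integrable_inv_one_add_sq_of_represents χ ha hμ) τ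
  have hind : Integrable (fun t : ℝ ↦ ({τ} : Set ℝ).indicator (fun _ ↦ 2 * a) t) μ :=
    (integrable_indicator_iff (measurableSet_singleton τ)).2 (integrableOn_const h0.ne)
  have hle : ∀ t : ℝ, ({τ} : Set ℝ).indicator (fun _ ↦ 2 * a) t ≤ ‖weilMellin u (1 / 2 + t * I)‖ ^ 2 := by
    intro t
    by_cases ht : t ∈ ({τ} : Set ℝ)
    · rw [indicator_of_mem ht, mem_singleton_iff.1 ht, hu, norm_sq_weilMellin_modulated_chi_zero_self ha]
    · rw [indicator_of_notMem ht]; positivity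
  calc 2 * a * μ.real {τ} = ∫ t, ({τ} : Set ℝ).indicator (fun _ ↦ 2 * a) t ∂μ := by
        rw [integral_indicator_const _ (measurableSet_singleton τ), smul_eq_mul, mul_comm]
    _ ≤ ∫ t, ‖weilMellin u (1 / 2 + t * I)‖ ^ 2 ∂μ := integral_mono hind hint hle
    _ = _ := heq.symm

/-- **ONE WINDOW BOUNDS THE SPECTRAL MASS OF A WHOLE INTERVAL** (one window, GRH-free):
`(8a/π²)·μ[τ − π/(2a), τ + π/(2a)] ≤ 𝓔^χ_a(e^{−iτx}χ_0) − M^χ_a` (Jordan's inequality). -/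
theorem mul_measureReal_Icc_le_twistedWindowForm (hq : q ≠ 1) (χ : DirichletCharacter ℂ q) (ha : 0 < a)
    {μ : Measure ℝ}
    (hμ : ∀ g : ℝ → ℂ, IsWeilTest g → tsupport g ⊆ Icc (-a) a →
      Integrable (fun t : ℝ ↦ ‖weilMellin g (1 / 2 + t * I)‖ ^ 2) μ ∧
        weilQuadraticChar χ g = ((∫ t, ‖weilMellin g (1 / 2 + t * I)‖ ^ 2 ∂μ : ℝ) : ℂ)) (τ : ℝ) :
    8 * a / π ^ 2 * μ.real (Icc (τ - π / (2 * a)) (τ + π / (2 * a))) ≤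
      weilDirichletEnergyChar χ a (fun x ↦ cexp (I * ((-τ) * x : ℝ)) * chi a 0 x) -
        weilMarkovConstantChar χ a := by
  obtain ⟨hint, heq⟩ := twistedWindowForm_modulated_eq_integral hq χ ha hμ τ
  set u : ℝ → ℂ := fun x ↦ cexp (I * ((-τ) * x : ℝ)) * chi a 0 x with hu
  set J : Set ℝ := Icc (τ - π / (2 * a)) (τ + π / (2 * a)) with hJ
  have h0 := measure_Icc_lt_top_of_integrable (integrable_inv_one_add_sq_of_represents χ ha hμ)
    (τ - π / (2 * a)) (τ + π / (2 * a))
  have hind : Integrable (fun t : ℝ ↦ J.indicator (fun _ ↦ 8 * a / π ^ 2) t) μ :=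
    (integrable_indicator_iff measurableSet_Icc).2 (integrableOn_const h0.ne)
  have hle : ∀ t : ℝ, J.indicator (fun _ ↦ 8 * a / π ^ 2) t ≤ ‖weilMellin u (1 / 2 + t * I)‖ ^ 2 := by
    intro t
    by_cases ht : t ∈ J
    · rw [indicator_of_mem ht, hu]
      refine le_norm_sq_weilMellin_modulated_of_abs_le ha (abs_le.2 ⟨?_, ?_⟩) <;> linarith [ht.1, ht.2]
    · rw [indicator_of_notMem ht]; positivity
  calc 8 * a / π ^ 2 * μ.real J = ∫ t, J.indicator (fun _ ↦ 8 * a / π ^ 2) t ∂μ := by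
        rw [integral_indicator_const _ measurableSet_Icc, smul_eq_mul, mul_comm]
    _ ≤ ∫ t, ‖weilMellin u (1 / 2 + t * I)‖ ^ 2 ∂μ := integral_mono hind hint hle
    _ = _ := heq.symm

/-- **THE RATE** (one window, GRH-free): `𝓔^χ_a(e^{−iτx}χ_0) − M^χ_a ≤ 2a·μ{τ} + (2/a)∫((t−τ)²)⁻¹dμ`. -/
theorem twistedWindowForm_modulated_le_atom_add (hq : q ≠ 1) (χ : DirichletCharacter ℂ q) (ha : 0 < a)
    {μ : Measure ℝ}
    (hμ : ∀ g : ℝ → ℂ, IsWeilTest g → tsupport g ⊆ Icc (-a) a →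
      Integrable (fun t : ℝ ↦ ‖weilMellin g (1 / 2 + t * I)‖ ^ 2) μ ∧
        weilQuadraticChar χ g = ((∫ t, ‖weilMellin g (1 / 2 + t * I)‖ ^ 2 ∂μ : ℝ) : ℂ)) (τ : ℝ)
    (hM : Integrable (fun t : ℝ ↦ ((t - τ) ^ 2)⁻¹) μ) :
    weilDirichletEnergyChar χ a (fun x ↦ cexp (I * ((-τ) * x : ℝ)) * chi a 0 x) -
        weilMarkovConstantChar χ a ≤
      2 * a * μ.real {τ} + 2 / a * ∫ t, ((t - τ) ^ 2)⁻¹ ∂μ := by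
  obtain ⟨hint, heq⟩ := twistedWindowForm_modulated_eq_integral hq χ ha hμ τ
  have h0 := measure_singleton_lt_top_of_integrable (integrable_inv_one_add_sq_of_represents χ ha hμ) τ
  have hind : Integrable (fun t : ℝ ↦ ({τ} : Set ℝ).indicator (fun _ ↦ 2 * a) t) μ :=
    (integrable_indicator_iff (measurableSet_singleton τ)).2 (integrableOn_const h0.ne)
  rw [heq]
  calc ∫ t, ‖weilMellin (fun x ↦ cexp (I * ((-τ) * x : ℝ)) * chi a 0 x) (1 / 2 + t * I)‖ ^ 2 ∂μ
      ≤ ∫ t, ({τ} : Set ℝ).indicator (fun _ ↦ 2 * a) t + 2 / a * ((t - τ) ^ 2)⁻¹ ∂μ :=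
        integral_mono hint (hind.add (hM.const_mul _)) (norm_sq_weilMellin_modulated_le_majorant ha τ)
    _ = 2 * a * μ.real {τ} + 2 / a * ∫ t, ((t - τ) ^ 2)⁻¹ ∂μ := by
        rw [integral_add hind (hM.const_mul _), integral_indicator_const _ (measurableSet_singleton τ),
          integral_const_mul, smul_eq_mul, mul_comm (μ.real {τ})]

/-- **THE BUDGET OF A TWISTED WINDOW AT HEIGHT `τ`** (prime side only; `χ` mod `q`, `a > 0`, `τ ∈ ℝ`):
`𝓔^χ_a(e^{−iτx}χ_0) − M^χ_a ≤ log q − K_κ + [Re ψ(¼+iτ/2) − Re ψ(¼)] + 5/a + 2Σ_{log n<2a}Λ(n)n^{-1/2}(1 − log n/(2a))`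
(gen7's closed form + gen9's modulation cost + `|Re(χ(n)n^{−iτ})| ≤ 1`). -/
theorem twistedWindowForm_modulated_le_budget (χ : DirichletCharacter ℂ q) (ha : 0 < a) (τ : ℝ) :
    weilDirichletEnergyChar χ a (fun x ↦ cexp (I * ((-τ) * x : ℝ)) * chi a 0 x) - weilMarkovConstantChar χ a ≤
      Real.log q - (Real.log (4 * π) + Real.eulerMascheroniConstant +
          2 * ∫ t in Ioi (0 : ℝ), weilKillingDensityPar (charParity χ) t) +
        (Literature.Analysis.SpecialFunctions.reDigammaQuarter τ -
          Literature.Analysis.SpecialFunctions.reDigammaQuarter 0) + 5 / a +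
        2 * (∑ n ∈ weilPrimeIndex a, (Λ n : ℝ) / Real.sqrt n * (1 - Real.log n / (2 * a))) := by
  have h := twistedWindowForm_modulated_chi_zero χ ha (-τ)
  rw [integral_norm_sq_modulated_chi_zero ha, mul_one] at h
  have hcos : ∀ t : ℝ, Real.cos (-τ * t) = Real.cos (τ * t) := fun t ↦ by rw [neg_mul, Real.cos_neg]
  simp only [hcos] at h
  have hc := integral_modulationCost_le (charParity χ) ha τ
  have hs := neg_flatSum_le_modulated_flatSum χ ha τ
  rw [h]
  linarith

/-- **LOCAL LOG-DENSITY OF EVERY `χ`-WINDOW MEASURE FROM ONE RUNG** (GRH-free; `χ` mod `q ≠ 1`, `a > 0`, every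
positive `μ` representing `Q_χ` on the tests of `[-a, a]`, every `τ`):

  `μ[τ − π/(2a), τ + π/(2a)] ≤ (π²/(8a)) · ( log q − K_κ + [log(1+|τ|) + 3 − ψ(¼)] + 5/a + 2Σ_{log n<2a}Λ(n)n^{-1/2}(1 − log n/(2a)) )`

— the conductor enters as `log q` and the height as `log(1+|τ|)`: the local shape of the counting law
`(T/π)log(qT/2πe)` (gen6, all windows) as an UPPER bound from a single window. -/
theorem measureReal_Icc_le_log_char (hq : q ≠ 1) (χ : DirichletCharacter ℂ q) (ha : 0 < a) {μ : Measure ℝ}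
    (hμ : ∀ g : ℝ → ℂ, IsWeilTest g → tsupport g ⊆ Icc (-a) a →
      Integrable (fun t : ℝ ↦ ‖weilMellin g (1 / 2 + t * I)‖ ^ 2) μ ∧
        weilQuadraticChar χ g = ((∫ t, ‖weilMellin g (1 / 2 + t * I)‖ ^ 2 ∂μ : ℝ) : ℂ)) (τ : ℝ) :
    μ.real (Icc (τ - π / (2 * a)) (τ + π / (2 * a))) ≤
      π ^ 2 / (8 * a) *
        (Real.log q - (Real.log (4 * π) + Real.eulerMascheroniConstant +
            2 * ∫ t in Ioi (0 : ℝ), weilKillingDensityPar (charParity χ) t) +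
          (Real.log (1 + |τ|) + 3 - Literature.Analysis.SpecialFunctions.reDigammaQuarter 0) + 5 / a +
          2 * (∑ n ∈ weilPrimeIndex a, (Λ n : ℝ) / Real.sqrt n * (1 - Real.log n / (2 * a)))) := by
  have h1 := mul_measureReal_Icc_le_twistedWindowForm hq χ ha hμ τ
  have h2 := twistedWindowForm_modulated_le_budget χ ha τ
  have h3 := Summit.RiemannHypothesis.RiemannHypothesis.Theorems.Handoff.reDigammaQuarter_le_log_add_three τ
  have hpos : 0 < 8 * a / π ^ 2 := by positivity
  have hπ : π ≠ 0 := Real.pi_ne_zero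
  have ha' : a ≠ 0 := ha.ne'
  have h1' : μ.real (Icc (τ - π / (2 * a)) (τ + π / (2 * a))) ≤
      π ^ 2 / (8 * a) * (weilDirichletEnergyChar χ a (fun x ↦ cexp (I * ((-τ) * x : ℝ)) * chi a 0 x) -
        weilMarkovConstantChar χ a) := by
    have h := (le_div_iff₀' hpos).2 h1
    calc _ ≤ _ := h
      _ = _ := by field_simp
  refine h1'.trans (mul_le_mul_of_nonneg_left ?_ (by positivity))
  linarith

/-! ## All windows: the twisted certificates are complete -/

/-- **THE TWISTED WINDOW CERTIFICATES ARE COMPLETE** (GRH-free): for every positive `μ` representing `Q_χ`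
on all tests and every `τ ∈ ℝ`, `(𝓔^χ_a(e^{−iτx}χ_0) − M^χ_a)/(2a) → μ{τ}` as `a → ∞`. -/
theorem tendsto_twistedWindowForm_modulated_div (hq : q ≠ 1) (χ : DirichletCharacter ℂ q) {μ : Measure ℝ}
    (hμ : ∀ g : ℝ → ℂ, IsWeilTest g →
      Integrable (fun t : ℝ ↦ ‖weilMellin g (1 / 2 + t * I)‖ ^ 2) μ ∧
        weilQuadraticChar χ g = ((∫ t, ‖weilMellin g (1 / 2 + t * I)‖ ^ 2 ∂μ : ℝ) : ℂ)) (τ : ℝ) :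
    Tendsto (fun a : ℝ ↦ (weilDirichletEnergyChar χ a (fun x ↦ cexp (I * ((-τ) * x : ℝ)) * chi a 0 x) -
        weilMarkovConstantChar χ a) / (2 * a)) atTop (𝓝 (μ.real {τ})) := by
  have hI : Integrable (fun t : ℝ ↦ (1 + t ^ 2)⁻¹) μ :=
    integrable_inv_one_add_sq_of_represents χ one_pos (fun g hg _ ↦ hμ g hg)
  set F : ℝ → ℝ → ℝ := fun a t ↦
    ‖weilMellin (fun x ↦ cexp (I * ((-τ) * x : ℝ)) * chi a 0 x) (1 / 2 + t * I)‖ ^ 2 / (2 * a) with hF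
  have hrepr : ∀ a : ℝ, 0 < a →
      Integrable (fun t : ℝ ↦
          ‖weilMellin (fun x ↦ cexp (I * ((-τ) * x : ℝ)) * chi a 0 x) (1 / 2 + t * I)‖ ^ 2) μ ∧
        weilDirichletEnergyChar χ a (fun x ↦ cexp (I * ((-τ) * x : ℝ)) * chi a 0 x) -
            weilMarkovConstantChar χ a =
          ∫ t, ‖weilMellin (fun x ↦ cexp (I * ((-τ) * x : ℝ)) * chi a 0 x) (1 / 2 + t * I)‖ ^ 2 ∂μ :=
    fun a ha ↦ twistedWindowForm_modulated_eq_integral hq χ ha (fun g hg _ ↦ hμ g hg) τ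
  have hlim : Tendsto (fun a ↦ ∫ t, F a t ∂μ) atTop
      (𝓝 (∫ t, ({τ} : Set ℝ).indicator (fun _ ↦ (1 : ℝ)) t ∂μ)) := by
    refine tendsto_integral_filter_of_dominated_convergence (fun t ↦ 4 * (1 + τ ^ 2) * (1 + t ^ 2)⁻¹)
      ?_ ?_ (hI.const_mul _) ?_
    · filter_upwards [eventually_gt_atTop (0 : ℝ)] with a ha
      exact ((hrepr a ha).1.div_const (2 * a)).aestronglyMeasurable
    · filter_upwards [eventually_ge_atTop (1 : ℝ)] with a ha
      refine Eventually.of_forall fun t ↦ ?_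
      rw [Real.norm_of_nonneg (by positivity)]
      exact norm_sq_weilMellin_modulated_div_le_majorant ha τ t
    · refine Eventually.of_forall fun t ↦ ?_
      rcases eq_or_ne t τ with rfl | ht
      · rw [indicator_of_mem (mem_singleton _)]
        refine tendsto_const_nhds.congr' ?_
        filter_upwards [eventually_gt_atTop (0 : ℝ)] with a ha
        show (1 : ℝ) = F a t
        rw [hF]
        dsimp only
        rw [norm_sq_weilMellin_modulated_chi_zero_self ha, div_self (by positivity)]
      · rw [indicator_of_notMem (by simpa using ht)]
        have hs2 : 0 < (t - τ) ^ 2 := by have := sub_ne_zero.2 ht; positivity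
        have h0 : Tendsto (fun a : ℝ ↦ (a ^ 2 * (t - τ) ^ 2)⁻¹) atTop (𝓝 0) :=
          tendsto_inv_atTop_zero.comp ((tendsto_pow_atTop two_ne_zero).atTop_mul_const hs2)
        refine squeeze_zero' ?_ ?_ h0
        · filter_upwards [eventually_gt_atTop (0 : ℝ)] with a ha
          positivity
        · filter_upwards [eventually_gt_atTop (0 : ℝ)] with a ha
          exact norm_sq_weilMellin_modulated_div_le_inv_sq ha ht
  rw [integral_indicator_const _ (measurableSet_singleton τ), smul_eq_mul, mul_one] at hlim
  refine hlim.congr' ?_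
  filter_upwards [eventually_gt_atTop (0 : ℝ)] with a ha
  rw [(hrepr a ha).2, hF]
  exact integral_div _ _

/-! ## Under `GRH(χ)`: the multiplicity of every zero of `L(s, χ)` is decided by one finite window -/

variable [NeZero q] {χ : DirichletCharacter ℂ q}

/-- **GRH ⟹ every twisted window-form value bounds every multiplicity**:
`2a · ord_{s=½+iτ} L(s,χ) ≤ 𝓔^χ_a(e^{−iτx}χ_0) − M^χ_a` for `a > 0`, `τ ∈ ℝ`. -/
theorem two_mul_mul_charZeroOrder_le_twistedWindowForm (hq : q ≠ 1) (hprim : χ.IsPrimitive)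
    (hGRH : χ.RiemannHypothesis) (ha : 0 < a) (τ : ℝ) :
    2 * a * (DirichletDisc.zeroOrder χ (1 / 2 + τ * I) : ℝ) ≤
      weilDirichletEnergyChar χ a (fun x ↦ cexp (I * ((-τ) * x : ℝ)) * chi a 0 x) -
        weilMarkovConstantChar χ a := by
  have hχ : χ ≠ 1 := ExplicitPsiChar.ne_one_of_isPrimitive hprim (lt_of_le_of_ne NeZero.one_le (Ne.symm hq))
  have h := two_mul_mul_atom_le_twistedWindowForm hq χ ha
    (fun _ hg _ ↦ WeilBochner.weilQuadraticChar_eq_integral_of_riemannHypothesis hq hprim hGRH hg) τ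
  rwa [measureReal_def, charZeroHeightMeasure_singleton_of_grh hχ hGRH τ, ENNReal.toReal_natCast] at h

/-- **GRH ⟹ AN EXPLICIT ZERO COUNT FOR `L(s, χ)` IN SHORT INTERVALS FROM ONE WINDOW** (`χ` primitive mod
`q ≠ 1`; `a > 0`, `τ ∈ ℝ`): the number of zeros `½+iγ` of `L(s, χ)` with `|γ − τ| ≤ π/(2a)`, with multiplicity, is
`≤ (π²/(8a))·(log q − K_κ + [log(1+|τ|) + 3 − ψ(¼)] + 5/a + 2Σ_{log n<2a}Λ(n)n^{-1/2}(1 − log n/(2a)))` — the local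
shape `log q + log|τ|` of `N(T, χ)` with explicit constants, from positivity at one window. -/
theorem charZeroCount_Icc_le_log_of_grh (hq : q ≠ 1) (hprim : χ.IsPrimitive) (hGRH : χ.RiemannHypothesis)
    (ha : 0 < a) (τ : ℝ) :
    (charZeroHeightMeasure χ).real (Icc (τ - π / (2 * a)) (τ + π / (2 * a))) ≤
      π ^ 2 / (8 * a) *
        (Real.log q - (Real.log (4 * π) + Real.eulerMascheroniConstant +
            2 * ∫ t in Ioi (0 : ℝ), weilKillingDensityPar (charParity χ) t) +
          (Real.log (1 + |τ|) + 3 - Literature.Analysis.SpecialFunctions.reDigammaQuarter 0) + 5 / a +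
          2 * (∑ n ∈ weilPrimeIndex a, (Λ n : ℝ) / Real.sqrt n * (1 - Real.log n / (2 * a)))) :=
  measureReal_Icc_le_log_char hq χ ha
    (fun _ hg _ ↦ WeilBochner.weilQuadraticChar_eq_integral_of_riemannHypothesis hq hprim hGRH hg) τ

/-- **GRH ⟹ THE ORDER OF EVERY ZERO OF `L(s, χ)` IS THE LIMIT OF THE NORMALISED TWISTED WINDOW FORMS**:
`(𝓔^χ_a(e^{−iτx}χ_0) − M^χ_a)/(2a) → ord_{s=½+iτ} L(s, χ)` as `a → ∞`. -/
theorem tendsto_twistedWindowForm_modulated_div_of_grh (hq : q ≠ 1) (hprim : χ.IsPrimitive)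
    (hGRH : χ.RiemannHypothesis) (τ : ℝ) :
    Tendsto (fun a : ℝ ↦ (weilDirichletEnergyChar χ a (fun x ↦ cexp (I * ((-τ) * x : ℝ)) * chi a 0 x) -
        weilMarkovConstantChar χ a) / (2 * a)) atTop (𝓝 (DirichletDisc.zeroOrder χ (1 / 2 + τ * I) : ℝ)) := by
  have hχ : χ ≠ 1 := ExplicitPsiChar.ne_one_of_isPrimitive hprim (lt_of_le_of_ne NeZero.one_le (Ne.symm hq))
  have h := tendsto_twistedWindowForm_modulated_div hq χ
    (fun _ hg ↦ WeilBochner.weilQuadraticChar_eq_integral_of_riemannHypothesis hq hprim hGRH hg) τ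
  rwa [measureReal_def, charZeroHeightMeasure_singleton_of_grh hχ hGRH τ, ENNReal.toReal_natCast] at h

/-- **GRH ⟹ THE ORDER OF EVERY ZERO OF `L(s, χ)` IS DECIDED BY ONE FINITE WINDOW**: for `τ ∈ ℝ`, `k ∈ ℕ`,
`ord_{s=½+iτ} L(s,χ) ≤ k ↔ ∃ a > 0, 𝓔^χ_a(e^{−iτx}χ_0) − M^χ_a < 2a(k+1)`. -/
theorem charZeroOrder_le_iff_of_grh (hq : q ≠ 1) (hprim : χ.IsPrimitive) (hGRH : χ.RiemannHypothesis)
    (τ : ℝ) (k : ℕ) :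
    DirichletDisc.zeroOrder χ (1 / 2 + τ * I) ≤ k ↔
      ∃ a : ℝ, 0 < a ∧ weilDirichletEnergyChar χ a (fun x ↦ cexp (I * ((-τ) * x : ℝ)) * chi a 0 x) -
        weilMarkovConstantChar χ a < 2 * a * (k + 1) := by
  set m : ℕ := DirichletDisc.zeroOrder χ (1 / 2 + τ * I) with hm
  constructor
  · intro hk
    have hlt : (m : ℝ) < k + 1 := by exact_mod_cast Nat.lt_succ_of_le hk
    have h := tendsto_twistedWindowForm_modulated_div_of_grh hq hprim hGRH τ
    have hev := (h.eventually (gt_mem_nhds hlt)).and (eventually_gt_atTop (0 : ℝ))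
    obtain ⟨a, ha, ha0⟩ := hev.exists
    refine ⟨a, ha0, ?_⟩
    rw [div_lt_iff₀ (by positivity)] at ha
    linarith
  · rintro ⟨a, ha0, hlt⟩
    have h := two_mul_mul_charZeroOrder_le_twistedWindowForm hq hprim hGRH ha0 τ
    have h2 : (m : ℝ) < k + 1 := by
      by_contra hge
      rw [not_lt] at hge
      have : 2 * a * ((k : ℝ) + 1) ≤ 2 * a * (m : ℝ) := mul_le_mul_of_nonneg_left hge (by positivity)
      linarith
    have h3 : m < k + 1 := by exact_mod_cast h2
    omega

/-- **GRH ⟹ `L(½, χ) ≠ 0` IS DECIDED BY ONE FINITE WINDOW** (`χ` primitive mod `q ≠ 1`; `κ` the parity,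
`K_κ = log 4π + γ + 2∫₀^∞(e^{(1/2−κ)t} − 1)dt/(2sinh t)`, `I_κ(a) = ∫₀^∞ρ_κ(t)min(t,2a)dt`):

  `L(½, χ) ≠ 0 ↔ ∃ a > 0, log q − [2Σ_{log n<2a} Λ(n)n^{-1/2}(1 − log n/(2a))Re χ(n) + K_κ − I_κ(a)/a] < 2a`

— the flat-window inequality of the rung (`… ≤ log q`, gen7) must fail to be `2a`-tight at some window;
sound at every window (GRH-free at the measure level: an atom at the centre makes every window `2a`-slack),
complete in the limit (`tendsto_twistedWindowForm_modulated_div`). -/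
theorem LFunction_one_half_ne_zero_iff_of_grh (hq : q ≠ 1) (hprim : χ.IsPrimitive) (hGRH : χ.RiemannHypothesis) :
    χ.LFunction (1 / 2) ≠ 0 ↔
      ∃ a : ℝ, 0 < a ∧
        Real.log q -
          (2 * (∑ n ∈ weilPrimeIndex a,
                (Λ n : ℝ) / Real.sqrt n * ((1 - Real.log n / (2 * a)) * (χ (n : ZMod q)).re)) +
            (Real.log (4 * π) + Real.eulerMascheroniConstant +
              2 * ∫ t in Ioi (0 : ℝ), weilKillingDensityPar (charParity χ) t) -
            1 / a * ∫ t in Ioi (0 : ℝ), weilArchDensityPar (charParity χ) t * min t (2 * a)) < 2 * a := by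
  have hχ : χ ≠ 1 := ExplicitPsiChar.ne_one_of_isPrimitive hprim (lt_of_le_of_ne NeZero.one_le (Ne.symm hq))
  have hiff := charZeroOrder_le_iff_of_grh hq hprim hGRH 0 0
  have e0 : (1 / 2 + ((0 : ℝ) : ℂ) * I : ℂ) = 1 / 2 := by simp
  rw [e0, Nat.le_zero, Nat.cast_zero, zero_add] at hiff
  have hord : DirichletDisc.zeroOrder χ (1 / 2) = 0 ↔ χ.LFunction (1 / 2) ≠ 0 := by
    rw [← not_iff_not, ← Ne, ← pos_iff_ne_zero, DirichletDisc.zeroOrder_pos_iff χ hχ, not_not]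
  rw [← hord, hiff]
  refine exists_congr fun a ↦ and_congr_right fun ha ↦ ?_
  have hu : (fun x : ℝ ↦ cexp (I * ((-0 : ℝ) * x : ℝ)) * chi a 0 x) = chi a 0 := by
    funext x; simp
  rw [hu, ← twistedWindowForm_chi_zero χ ha, integral_norm_sq_chi_zero ha, mul_one, mul_one]

/-- **GRH ⟹ CERTIFICATE LENGTH AT THE CENTRAL POINT**: if `L(½, χ) ≠ 0` then EVERY window with
`a² > Σ_ρ m_ρ/γ_ρ²` (the second inverse moment of the zeros of `L(s, χ)`) certifies it:
`log q − [2Σ_{log n<2a}Λ(n)n^{-1/2}(1 − log n/(2a))Re χ(n) + K_κ − I_κ(a)/a] < 2a`.  (From the rate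
`T^χ_a(χ_0) ≤ 2a·ord_{½} + (2/a)Σ_ρ m/γ²`; the sum is finite unconditionally, `integrable_inv_sq_charZeroHeightMeasure`.) -/
theorem twistedFlatWindow_lt_of_grh (hq : q ≠ 1) (hprim : χ.IsPrimitive) (hGRH : χ.RiemannHypothesis)
    (hL : χ.LFunction (1 / 2) ≠ 0) (ha : 0 < a)
    (hM : ∫ t, (t ^ 2)⁻¹ ∂(charZeroHeightMeasure χ) < a ^ 2) :
    Real.log q -
        (2 * (∑ n ∈ weilPrimeIndex a,
              (Λ n : ℝ) / Real.sqrt n * ((1 - Real.log n / (2 * a)) * (χ (n : ZMod q)).re)) +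
          (Real.log (4 * π) + Real.eulerMascheroniConstant +
            2 * ∫ t in Ioi (0 : ℝ), weilKillingDensityPar (charParity χ) t) -
          1 / a * ∫ t in Ioi (0 : ℝ), weilArchDensityPar (charParity χ) t * min t (2 * a)) < 2 * a := by
  have hq1 : 1 < q := lt_of_le_of_ne NeZero.one_le (Ne.symm hq)
  have hχ : χ ≠ 1 := ExplicitPsiChar.ne_one_of_isPrimitive hprim hq1
  have hμ : ∀ g : ℝ → ℂ, IsWeilTest g → tsupport g ⊆ Icc (-a) a →
      Integrable (fun t : ℝ ↦ ‖weilMellin g (1 / 2 + t * I)‖ ^ 2) (charZeroHeightMeasure χ) ∧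
        weilQuadraticChar χ g = ((∫ t, ‖weilMellin g (1 / 2 + t * I)‖ ^ 2 ∂charZeroHeightMeasure χ : ℝ) : ℂ) :=
    fun _ hg _ ↦ WeilBochner.weilQuadraticChar_eq_integral_of_riemannHypothesis hq hprim hGRH hg
  have hM0 : Integrable (fun t : ℝ ↦ ((t - 0) ^ 2)⁻¹) (charZeroHeightMeasure χ) := by
    simpa only [sub_zero] using integrable_inv_sq_charZeroHeightMeasure hprim hq1
  have h := twistedWindowForm_modulated_le_atom_add hq χ ha hμ 0 hM0
  simp only [sub_zero] at h
  -- no atom at the centre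
  have hord : DirichletDisc.zeroOrder χ (1 / 2) = 0 := by
    by_contra hne
    exact hL ((DirichletDisc.zeroOrder_pos_iff χ hχ _).1 (Nat.pos_of_ne_zero hne))
  have hatom : (charZeroHeightMeasure χ).real {0} = 0 := by
    have e0 : (1 / 2 + ((0 : ℝ) : ℂ) * I : ℂ) = 1 / 2 := by simp
    rw [measureReal_def, charZeroHeightMeasure_singleton_of_grh hχ hGRH 0, e0, hord, Nat.cast_zero,
      ENNReal.toReal_zero]
  rw [hatom, mul_zero, zero_add] at h
  have hu : (fun x : ℝ ↦ cexp (I * ((-0 : ℝ) * x : ℝ)) * chi a 0 x) = chi a 0 := by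
    funext x; simp
  rw [hu] at h
  have hcl := twistedWindowForm_chi_zero χ ha
  rw [integral_norm_sq_chi_zero ha, mul_one] at hcl
  rw [hcl] at h
  have h2 : 2 / a * ∫ t, (t ^ 2)⁻¹ ∂charZeroHeightMeasure χ < 2 / a * a ^ 2 :=
    mul_lt_mul_of_pos_left hM (by positivity)
  have h3 : 2 / a * a ^ 2 = 2 * a := by field_simp
  linarith

end Summit.Ventures.WeilGRH

end
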